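import Mathlib
import Summits.CriticalPhenomena.PercolationContinuityZ3.Theorems.PercNearOneGluingNoHeavyLowerTailHemisphere
import HarnessLib
import HarnessLib.Audit

/-!
# Pure K♯ from the three-family Marica–Schönheim inequality P′ (hp-7 gen 85)

Support file for crux `stmt-CriticalPhenomena-4575` (`NoHeavyLowerTail`, route `PercNearOneGluingNoHeavy`), hull-port seat `prim-hp-7`
(generation 85); `--supports stmt-CriticalPhenomena-4575`.  No `sorry`.
Memo `run/shared/lean/prim/prim-hp-7/FROM-prim-hp-7-g85-HEMISPHERE.md` §0 (B).

A pair of monotone labellings `(g, h)` is PURE if every debtor set has a single-arc support, i.e. `(g q, h qᶜ) = (C_x, C_y)` with `x ≠ y`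
(hexagon language: every debtor value is a vertex; this is the 'pure' class of the gen-82/83 memos, containing `ConjectureHexMS`'s instances).
For a pure pair the hemisphere family of the petal order `a < b < c` is the disjoint union of the three PURE CLASSES `pclass a b`, `pclass a c`,
`pclass b c` (`hemisphere_eq_of_pure`); classes of different arcs are CROSS-SPERNER (`crossSperner_pclass`); any two sets of the adjacent double
classes `pclass a b ∪ pclass a c` and `pclass a c ∪ pclass b c` are close (`linked_of_mem_adjacent`), so all their differences are generated
anti-donors.  Hence the purely extremal statement

* `PPrime` — **Conjecture P′** (three-family Marica–Schönheim, gen 85): for pairwise cross-Sperner families `𝒜, ℬ, 𝒞` of finite sets with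
  `|ℬ| ≥ |𝒜|, |𝒞|`:  `|𝒜| + |ℬ| + |𝒞| ≤ |Δ(𝒜 ∪ ℬ) ∪ Δ(ℬ ∪ 𝒞)|`, `Δ(𝒳) = 𝒳 \\ 𝒳 = {X \ Y}` (Marica–Schönheim for `𝒜∪ℬ∪𝒞` without the far
  differences `𝒜 \ 𝒞`, `𝒞 \ 𝒜`).  Evidence: 0 failures in ≈1.7·10^5 random instances `n ≤ 7` and under slack-annealing `n ≤ 12` (kit j313941); both
  hypotheses are necessary.  An obligation of this programme, never used as a fact —

implies the K♯ inequality for every pure pair (`kSharp_ineq_of_pprime_of_pure`), choosing the petal order whose middle class `pclass a c` is the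
largest (`exists_order_middle_largest`).
-/

namespace Summit.CriticalPhenomena.PercolationContinuityZ3.Theorems

namespace GeneratedDonors

open Finset FinsetFamily OrientedAntipodalHall AntipodalStrongHarris AntipodalStrongHarris.Lab

section Defs

variable {α : Type*} [Fintype α] [DecidableEq α]

/-- `(g, h)` is PURE: every debtor set `q` has `(g q, h qᶜ) = (C_x, C_y)` for petals `x ≠ y` (its hexagon value is a vertex). -/
def Pure (g h : Finset α → Lab 3) : Prop :=
  ∀ q ∈ debtors g h, ∃ x y : Fin 3, x ≠ y ∧ g q = petal x ∧ h (univ \ q) = petal y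

/-- The PURE CLASS of the arc `(x, y)`: debtors with `(g q, h qᶜ) = (C_x, C_y)` and `(g qᶜ, h q) = (C_y, C_x)`. -/
def pclass (g h : Finset α → Lab 3) (x y : Fin 3) : Finset (Finset α) :=
  {q ∈ debtors g h | g q = petal x ∧ h (univ \ q) = petal y ∧ g (univ \ q) = petal y ∧ h q = petal x}

/-- Two families are CROSS-SPERNER: no member of one is contained in a member of the other. -/
def CrossSperner (A B : Finset (Finset α)) : Prop := ∀ a ∈ A, ∀ b ∈ B, ¬ a ⊆ b ∧ ¬ b ⊆ a

end Defs

/-- **Conjecture P′** (three-family Marica–Schönheim, hp-7 gen 85).  An obligation, not a fact. -/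
def PPrime : Prop :=
  ∀ (α : Type) [Fintype α] [DecidableEq α] (A B C : Finset (Finset α)),
    CrossSperner A B → CrossSperner B C → CrossSperner A C → #A ≤ #B → #C ≤ #B →
      #A + #B + #C ≤ #(((A ∪ B) \\ (A ∪ B)) ∪ ((B ∪ C) \\ (B ∪ C)))

/-- **CONJECTURE P′** as a typed obligation. [this work; obligation] -/
@[conjecture] def ConjecturePPrime : Prop := PPrime

section PureStructure

variable {α : Type} [Fintype α] [DecidableEq α]

/-- The support of a single-arc label pair `(C_x, C_y)`, `x ≠ y`, is exactly the arc `(x, y)`. -/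
theorem inSupp_petal_petal_iff {x y : Fin 3} (hxy : x ≠ y) (a b : Fin 3) :
    InSupp (petal x) (petal y) a b ↔ a = x ∧ b = y := by
  unfold InSupp
  constructor
  · rintro ⟨-, h1 | h1, h2 | h2⟩
    · cases h2
    · exact ⟨(petal.inj h1).symm, (petal.inj h2).symm⟩
    · cases h1
    · cases h1
  · rintro ⟨rfl, rfl⟩
    exact ⟨hxy, Or.inl rfl, Or.inr rfl⟩

/-- Membership in a pure class. -/
theorem mem_pclass {g h : Finset α → Lab 3} {x y : Fin 3} {q : Finset α} :
    q ∈ pclass g h x y ↔ q ∈ debtors g h ∧ g q = petal x ∧ h (univ \ q) = petal y ∧ g (univ \ q) = petal y ∧ h q = petal x := by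
  unfold pclass; rw [mem_filter]

/-- In a pure pair every debtor lies in the pure class of its own arc, and that arc has `x ≠ y`. -/
theorem exists_mem_pclass_of_pure {g h : Finset α → Lab 3} (hp : Pure g h) {q : Finset α} (hq : q ∈ debtors g h) :
    ∃ x y : Fin 3, x ≠ y ∧ q ∈ pclass g h x y := by
  obtain ⟨x, y, hxy, h1, h2⟩ := hp q hq
  obtain ⟨x', y', hxy', h3, h4⟩ := hp _ (compl_mem_debtors hq)
  rw [sdiff_sdiff_univ] at h4
  -- the charging arc forces (x', y') = (y, x)
  have hch : IsCharged 3 g h q := by unfold debtors at hq; exact (mem_filter.mp hq).2.1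
  obtain ⟨a, b, -, ha1, ha2, ha3, ha4⟩ := hch
  rw [h1] at ha1; rw [h4] at ha2; rw [h3] at ha3; rw [h2] at ha4
  have e1 : x = a := by rcases ha1 with h' | h' <;> [exact petal.inj h'; cases h']
  have e2 : y' = a := by rcases ha2 with h' | h' <;> [cases h'; exact petal.inj h']
  have e3 : x' = b := by rcases ha3 with h' | h' <;> [exact petal.inj h'; cases h']
  have e4 : y = b := by rcases ha4 with h' | h' <;> [cases h'; exact petal.inj h']
  refine ⟨x, y, hxy, mem_pclass.mpr ⟨hq, h1, h2, ?_, ?_⟩⟩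
  · rw [h3, e3, e4]
  · rw [h4, e2, e1]

/-- Pure classes of different arcs are disjoint. -/
theorem disjoint_pclass {g h : Finset α → Lab 3} {x y x' y' : Fin 3} (hne : (x, y) ≠ (x', y')) :
    Disjoint (pclass g h x y) (pclass g h x' y') := by
  rw [disjoint_left]
  intro q h1 h2
  obtain ⟨-, a1, a2, -, -⟩ := mem_pclass.mp h1
  obtain ⟨-, b1, b2, -, -⟩ := mem_pclass.mp h2
  exact hne (by rw [a1] at b1; rw [a2] at b2; rw [petal.inj b1, petal.inj b2])

/-- For monotone labellings, pure classes of different arcs are cross-Sperner (petal labels are pairwise incomparable). -/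
theorem crossSperner_pclass {g h : Finset α → Lab 3}
    (hg : ∀ ⦃X Y : Finset α⦄, X ⊆ Y → g X ≤ g Y) (hh : ∀ ⦃X Y : Finset α⦄, X ⊆ Y → h X ≤ h Y)
    {x y x' y' : Fin 3} (hne : (x, y) ≠ (x', y')) : CrossSperner (pclass g h x y) (pclass g h x' y') := by
  -- one inclusion direction suffices by symmetry
  have key : ∀ {x y x' y' : Fin 3}, (x, y) ≠ (x', y') → ∀ q ∈ pclass g h x y, ∀ s ∈ pclass g h x' y', ¬ q ⊆ s := by
    intro x y x' y' hne q hq s hs hqs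
    obtain ⟨-, a1, a2, -, -⟩ := mem_pclass.mp hq
    obtain ⟨-, b1, b2, -, -⟩ := mem_pclass.mp hs
    have e1 : x = x' := by
      have := hg hqs; rw [a1, b1, le_def] at this
      rcases this with h' | h' | h'
      · cases h'
      · cases h'
      · exact petal.inj h'
    have e2 : y = y' := by
      have := hh (sdiff_subset_sdiff (subset_refl (univ : Finset α)) hqs); rw [a2, b2, le_def] at this
      rcases this with h' | h' | h'
      · cases h'
      · cases h'
      · exact (petal.inj h').symm
    exact hne (by rw [e1, e2])
  intro q hq s hs
  exact ⟨key hne q hq s hs, key (Ne.symm hne) s hs q hq⟩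

/-- **Pure hemisphere = three pure classes.**  For a pure pair and a petal order `a<b<c`, the hemisphere family is
`pclass a b ∪ pclass a c ∪ pclass b c`. -/
theorem hemisphere_eq_of_pure {g h : Finset α → Lab 3} (hp : Pure g h) {a b c : Fin 3} (hab : a ≠ b) (hbc : b ≠ c) (hac : a ≠ c) :
    hemisphere g h a b c = pclass g h a b ∪ pclass g h a c ∪ pclass g h b c := by
  ext q
  rw [mem_union, mem_union, mem_hemisphere]
  constructor
  · rintro ⟨hq, hthru, -⟩
    obtain ⟨x, y, hxy, hmem⟩ := exists_mem_pclass_of_pure hp hq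
    obtain ⟨-, h1, h2, -, -⟩ := mem_pclass.mp hmem
    -- a forward arc through q must be (x, y)
    have harc : ∀ u v : Fin 3, Thru g h u v q → u = x ∧ v = y := by
      rintro u v ⟨⟨-, hu, hv⟩, -⟩
      rw [h1] at hu; rw [h2] at hv
      constructor
      · rcases hu with h' | h' <;> [exact (petal.inj h').symm; cases h']
      · rcases hv with h' | h' <;> [cases h'; exact (petal.inj h').symm]
    rcases hthru with ht | ht | ht
    · obtain ⟨rfl, rfl⟩ := harc a b ht; exact Or.inl (Or.inl hmem)
    · obtain ⟨rfl, rfl⟩ := harc a c ht; exact Or.inl (Or.inr hmem)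
    · obtain ⟨rfl, rfl⟩ := harc b c ht; exact Or.inr hmem
  · intro hq
    -- a member of a forward pure class is a forward debtor and not exceptional
    have aux : ∀ {u v : Fin 3}, u ≠ v → q ∈ pclass g h u v → q ∈ debtors g h ∧ Thru g h u v q ∧ ¬ Exceptional g h b q := by
      intro u v huv hm
      obtain ⟨hd, h1, h2, h3, h4⟩ := mem_pclass.mp hm
      refine ⟨hd, ⟨⟨huv, Or.inl h1, Or.inr h2⟩, ⟨huv.symm, Or.inl h3, Or.inr h4⟩⟩, ?_⟩
      rintro ⟨ht, -, -, -⟩; rw [h1] at ht; cases ht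
    rcases hq with (hq | hq) | hq
    · obtain ⟨hd, ht, he⟩ := aux hab hq; exact ⟨hd, Or.inl ht, he⟩
    · obtain ⟨hd, ht, he⟩ := aux hac hq; exact ⟨hd, Or.inr (Or.inl ht), he⟩
    · obtain ⟨hd, ht, he⟩ := aux hbc hq; exact ⟨hd, Or.inr (Or.inr ht), he⟩

/-- **Closeness of pure classes**: if `q ∈ pclass x y` and `s ∈ pclass x' y'` with `y ≠ x'`, `x ≠ y'` and `(x,y) ≠ (y',x')`, then `q` is close to `s`
(`qᶜ` linked to `s`), so `q \ s` is a generated anti-donor.  For the three classes of a hemisphere this covers every ordered pair inside the two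
adjacent double classes. -/
theorem linked_of_mem_pclass {g h : Finset α → Lab 3} {x y x' y' : Fin 3} {q s : Finset α}
    (hq : q ∈ pclass g h x y) (hs : s ∈ pclass g h x' y') (h1 : y ≠ x') (h2 : x ≠ y') (h3 : (x, y) ≠ (y', x')) :
    Linked g h (univ \ q) s := by
  obtain ⟨hqd, q1, q2, q3, q4⟩ := mem_pclass.mp hq
  obtain ⟨hsd, s1, s2, s3, s4⟩ := mem_pclass.mp hs
  -- the arc of a debtor has distinct ends (it carries a charge)
  have arc_ne : ∀ {r : Finset α} {u v : Fin 3}, r ∈ debtors g h → g r = petal u → h (univ \ r) = petal v → u ≠ v := by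
    intro r u v hr hu hv e
    have hch : IsCharged 3 g h r := by unfold debtors at hr; exact (mem_filter.mp hr).2.1
    obtain ⟨a', b', hab', ha1, -, -, ha4⟩ := hch
    rw [hu] at ha1; rw [hv] at ha4
    have e1 : u = a' := by rcases ha1 with h' | h' <;> [exact petal.inj h'; cases h']
    have e4 : v = b' := by rcases ha4 with h' | h' <;> [cases h'; exact petal.inj h']
    exact hab' (by rw [← e1, ← e4]; exact e)
  have hxy : x ≠ y := arc_ne hqd q1 q2
  have hxy' : x' ≠ y' := arc_ne hsd s1 s2
  unfold Linked
  rw [sdiff_sdiff_univ, q3, q4, s1, s2, q1, q2, s3, s4]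
  refine ⟨?_, ?_, ?_⟩
  · rintro ⟨a0, ha0⟩
    have t1 := ha0 y x (Or.inl ((inSupp_petal_petal_iff hxy.symm y x).mpr ⟨rfl, rfl⟩))
    have t2 := ha0 x' y' (Or.inr ((inSupp_petal_petal_iff hxy' x' y').mpr ⟨rfl, rfl⟩))
    exact h1 (t1.trans t2.symm)
  · rintro ⟨b0, hb0⟩
    have t1 := hb0 y x (Or.inl ((inSupp_petal_petal_iff hxy.symm y x).mpr ⟨rfl, rfl⟩))
    have t2 := hb0 x' y' (Or.inr ((inSupp_petal_petal_iff hxy' x' y').mpr ⟨rfl, rfl⟩))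
    exact h2 (t1.trans t2.symm)
  · rintro a0 b0 ⟨k1, k2⟩
    obtain ⟨f1, f2⟩ := (inSupp_petal_petal_iff hxy a0 b0).mp k1
    obtain ⟨e1, e2⟩ := (inSupp_petal_petal_iff (Ne.symm hxy') a0 b0).mp k2
    exact h3 (by rw [← f1, ← f2, e1, e2])

end PureStructure

section Reduction

variable {α : Type} [Fintype α] [DecidableEq α]

/-- Complementation is a bijection `pclass x y → pclass y x`; in particular the two classes are equinumerous. -/
theorem card_pclass_swap (g h : Finset α → Lab 3) (x y : Fin 3) : #(pclass g h y x) = #(pclass g h x y) := by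
  classical
  have himg : pclass g h y x = (pclass g h x y).image (fun q => univ \ q) := by
    ext q
    rw [mem_image]
    constructor
    · intro hq
      obtain ⟨hd, h1, h2, h3, h4⟩ := mem_pclass.mp hq
      refine ⟨univ \ q, mem_pclass.mpr ⟨compl_mem_debtors hd, h3, ?_, ?_, h2⟩, sdiff_sdiff_univ q⟩
      · rw [sdiff_sdiff_univ]; exact h4
      · rw [sdiff_sdiff_univ]; exact h1
    · rintro ⟨r, hr, rfl⟩
      obtain ⟨hd, h1, h2, h3, h4⟩ := mem_pclass.mp hr
      refine mem_pclass.mpr ⟨compl_mem_debtors hd, h3, ?_, ?_, h2⟩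
      · rw [sdiff_sdiff_univ]; exact h4
      · rw [sdiff_sdiff_univ]; exact h1
  rw [himg]
  refine card_image_of_injOn fun q _ r _ hqr => ?_
  have := congrArg (fun s => (univ : Finset α) \ s) hqr
  simpa only [sdiff_sdiff_univ] using this

/-- **Choice of the hemisphere**: some petal order `a<b<c` has its middle class `pclass a c` at least as large as the two end classes. -/
theorem exists_order_middle_largest (g h : Finset α → Lab 3) :
    ∃ a b c : Fin 3, a ≠ b ∧ b ≠ c ∧ a ≠ c ∧
      #(pclass g h a b) ≤ #(pclass g h a c) ∧ #(pclass g h b c) ≤ #(pclass g h a c) := by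
  have s10 := card_pclass_swap g h 0 1
  have s21 := card_pclass_swap g h 1 2
  by_cases h1 : #(pclass g h 0 1) ≤ #(pclass g h 0 2) ∧ #(pclass g h 1 2) ≤ #(pclass g h 0 2)
  · exact ⟨0, 1, 2, by decide, by decide, by decide, h1.1, h1.2⟩
  by_cases h2 : #(pclass g h 0 2) ≤ #(pclass g h 0 1) ∧ #(pclass g h 1 2) ≤ #(pclass g h 0 1)
  · exact ⟨0, 2, 1, by decide, by decide, by decide, h2.1, by rw [s21]; exact h2.2⟩
  · refine ⟨1, 0, 2, by decide, by decide, by decide, ?_, ?_⟩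
    · rw [s10]; omega
    · omega

/-- In a pure pair, all differences inside the two adjacent double classes of a hemisphere are generated (close) differences. -/
theorem diffs_adjacent_subset_genOf {g h : Finset α → Lab 3} (hp : Pure g h) {a b c : Fin 3}
    (hab : a ≠ b) (hbc : b ≠ c) (hac : a ≠ c) :
    ((pclass g h a b ∪ pclass g h a c) \\ (pclass g h a b ∪ pclass g h a c)) ∪
        ((pclass g h a c ∪ pclass g h b c) \\ (pclass g h a c ∪ pclass g h b c)) ⊆
      genOf g h (hemisphere g h a b c) := by
  have hH := hemisphere_eq_of_pure hp hab hbc hac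
  have memH : ∀ {q}, q ∈ pclass g h a b ∨ q ∈ pclass g h a c ∨ q ∈ pclass g h b c → q ∈ hemisphere g h a b c := by
    intro q hq; rw [hH, mem_union, mem_union]; tauto
  have pne : ∀ {u v u' v' : Fin 3}, u ≠ u' → (u, v) ≠ (u', v') := fun huu e => huu (Prod.mk.inj e).1
  intro d hd
  rw [mem_union] at hd
  rcases hd with hd | hd
  · rw [mem_diffs] at hd
    obtain ⟨q, hq, s, hs, rfl⟩ := hd
    rw [mem_union] at hq hs
    refine mem_genOf.mpr ⟨q, memH (by tauto), s, memH (by tauto), ?_, rfl⟩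
    rcases hq with hq | hq <;> rcases hs with hs | hs
    · exact linked_of_mem_pclass hq hs hab.symm hab (pne hab)
    · exact linked_of_mem_pclass hq hs hab.symm hac (pne hac)
    · exact linked_of_mem_pclass hq hs hac.symm hab (pne hab)
    · exact linked_of_mem_pclass hq hs hac.symm hac (pne hac)
  · rw [mem_diffs] at hd
    obtain ⟨q, hq, s, hs, rfl⟩ := hd
    rw [mem_union] at hq hs
    refine mem_genOf.mpr ⟨q, memH (by tauto), s, memH (by tauto), ?_, rfl⟩
    rcases hq with hq | hq <;> rcases hs with hs | hs
    · exact linked_of_mem_pclass hq hs hac.symm hac (pne hac)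
    · exact linked_of_mem_pclass hq hs hbc.symm hac (pne hac)
    · exact linked_of_mem_pclass hq hs hac.symm hbc (pne hbc)
    · exact linked_of_mem_pclass hq hs hbc.symm hbc (pne hbc)

/-- **Conjecture P′ ⟹ the K♯ inequality for every pure pair** (hp-7 gen 85): take the petal order with the largest middle class; the hemisphere is
the disjoint union of three cross-Sperner classes, all differences inside the two adjacent double classes are generated, so P′ gives
`#hemisphere ≤ #genOf` and `kSharp_ineq_of_hemisphere` applies. -/
theorem kSharp_ineq_of_pprime_of_pure (hP : PPrime) (g h : Finset α → Lab 3)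
    (hg : ∀ ⦃X Y : Finset α⦄, X ⊆ Y → g X ≤ g Y) (hh : ∀ ⦃X Y : Finset α⦄, X ⊆ Y → h X ≤ h Y) (hp : Pure g h) :
    #{q ∈ (univ : Finset (Finset α)) | IsCharged 3 g h q} ≤
      #{q ∈ (univ : Finset (Finset α)) | (g q = top ∧ h (univ \ q) = bot) ∨ (g (univ \ q) = top ∧ h q = bot)} := by
  obtain ⟨a, b, c, hab, hbc, hac, hAB, hCB⟩ := exists_order_middle_largest g h
  have pne : ∀ {u v u' v' : Fin 3}, u ≠ u' → (u, v) ≠ (u', v') := fun huu e => huu (Prod.mk.inj e).1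
  have pne2 : ∀ {u v u' v' : Fin 3}, v ≠ v' → (u, v) ≠ (u', v') := fun hvv e => hvv (Prod.mk.inj e).2
  set A := pclass g h a b with hA
  set B := pclass g h a c with hB
  set C := pclass g h b c with hC
  have hcsAB : CrossSperner A B := crossSperner_pclass hg hh (pne2 hbc)
  have hcsBC : CrossSperner B C := crossSperner_pclass hg hh (pne hab)
  have hcsAC : CrossSperner A C := crossSperner_pclass hg hh (pne hab)
  have hPP := hP α A B C hcsAB hcsBC hcsAC hAB hCB
  have hdAB : Disjoint A B := disjoint_pclass (pne2 hbc)
  have hdAC : Disjoint A C := disjoint_pclass (pne hab)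
  have hdBC : Disjoint B C := disjoint_pclass (pne hab)
  have hcardH : #(hemisphere g h a b c) = #A + #B + #C := by
    rw [hemisphere_eq_of_pure hp hab hbc hac, card_union_of_disjoint (disjoint_union_left.mpr ⟨hdAC, hdBC⟩),
      card_union_of_disjoint hdAB]
  refine kSharp_ineq_of_hemisphere g h hg hh hab hbc hac ?_
  rw [hcardH]
  exact hPP.trans (card_le_card (diffs_adjacent_subset_genOf hp hab hbc hac))

/-- The same from the typed obligation: `ConjecturePPrime` settles K♯ for all pure monotone pairs. -/
theorem kSharp_ineq_of_conjecturePPrime_of_pure (hP : ConjecturePPrime) (g h : Finset α → Lab 3)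
    (hg : ∀ ⦃X Y : Finset α⦄, X ⊆ Y → g X ≤ g Y) (hh : ∀ ⦃X Y : Finset α⦄, X ⊆ Y → h X ≤ h Y) (hp : Pure g h) :
    #{q ∈ (univ : Finset (Finset α)) | IsCharged 3 g h q} ≤
      #{q ∈ (univ : Finset (Finset α)) | (g q = top ∧ h (univ \ q) = bot) ∨ (g (univ \ q) = top ∧ h q = bot)} :=
  kSharp_ineq_of_pprime_of_pure hP g h hg hh hp

end Reduction

/-! ### Appendix (gen 85, same session): the relative Marica–Schönheim conjecture REL-MS and REL-MS ⟹ P′ -/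

section RelMS

/-- **Conjecture REL-MS** (relative Marica–Schönheim, hp-7 gen 85): for a nonempty family `ℬ` and a family `𝒴` of sets each incomparable with every
member of `ℬ`, with `|𝒴| ≤ 2|ℬ|`, the differences that touch `ℬ` already number at least `|ℬ ∪ 𝒴|`:
`|ℬ| + |𝒴| ≤ |((ℬ ∪ 𝒴) \\ ℬ) ∪ (ℬ \\ (ℬ ∪ 𝒴))|`.  Evidence: 0 failures in 5·10^7 random and slack-annealed instances `n ≤ 12` (kit j313941);
false with `4|ℬ|` in place of `2|ℬ|` (44 random failures; for `|ℬ| = 1` the first failure is a `2 × 3` grid, `|𝒴| = 6`).  An obligation, not a fact. -/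
def RelMS : Prop :=
  ∀ (α : Type) [Fintype α] [DecidableEq α] (B Y : Finset (Finset α)),
    B.Nonempty → (∀ y ∈ Y, ∀ b ∈ B, ¬ y ⊆ b ∧ ¬ b ⊆ y) → #Y ≤ 2 * #B →
      #B + #Y ≤ #(((B ∪ Y) \\ B) ∪ (B \\ (B ∪ Y)))

/-- **CONJECTURE REL-MS** as a typed obligation. [this work; obligation] -/
@[conjecture] def ConjectureRelMS : Prop := RelMS

/-- **REL-MS ⟹ P′**: apply REL-MS to `ℬ` and `𝒴 = 𝒜 ∪ 𝒞`; every difference touching `ℬ` lies in `Δ(𝒜∪ℬ) ∪ Δ(ℬ∪𝒞)`. -/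
theorem pprime_of_relMS (hR : RelMS) : PPrime := by
  intro α _ _ A B C hAB hBC hAC hA hC
  classical
  -- A and C are disjoint (equal sets would be comparable)
  have hdisj : Disjoint A C := by
    rw [disjoint_left]; intro a ha hc; exact (hAC a ha a hc).1 (subset_refl a)
  by_cases hB : B = ∅
  · subst hB
    have hA0 : A = ∅ := card_eq_zero.mp (Nat.le_zero.mp (by simpa using hA))
    have hC0 : C = ∅ := card_eq_zero.mp (Nat.le_zero.mp (by simpa using hC))
    subst hA0; subst hC0; simp
  have hBne : B.Nonempty := nonempty_iff_ne_empty.mpr hB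
  have hY : ∀ y ∈ A ∪ C, ∀ b ∈ B, ¬ y ⊆ b ∧ ¬ b ⊆ y := by
    intro y hy b hb
    rcases mem_union.mp hy with hy | hy
    · exact hAB y hy b hb
    · obtain ⟨h1, h2⟩ := hBC b hb y hy; exact ⟨h2, h1⟩
  have hcardY : #(A ∪ C) = #A + #C := card_union_of_disjoint hdisj
  have hle : #(A ∪ C) ≤ 2 * #B := by rw [hcardY]; omega
  have hmain := hR α B (A ∪ C) hBne hY hle
  have hsub : ((B ∪ (A ∪ C)) \\ B) ∪ (B \\ (B ∪ (A ∪ C))) ⊆ ((A ∪ B) \\ (A ∪ B)) ∪ ((B ∪ C) \\ (B ∪ C)) := by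
    intro d hd
    rw [mem_union] at hd ⊢
    rcases hd with hd | hd
    · rw [mem_diffs] at hd
      obtain ⟨x, hx, b, hb, rfl⟩ := hd
      rw [mem_union, mem_union] at hx
      rcases hx with hx | hx | hx
      · exact Or.inl (mem_diffs.mpr ⟨x, mem_union_right _ hx, b, mem_union_right _ hb, rfl⟩)
      · exact Or.inl (mem_diffs.mpr ⟨x, mem_union_left _ hx, b, mem_union_right _ hb, rfl⟩)
      · exact Or.inr (mem_diffs.mpr ⟨x, mem_union_right _ hx, b, mem_union_left _ hb, rfl⟩)
    · rw [mem_diffs] at hd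
      obtain ⟨b, hb, x, hx, rfl⟩ := hd
      rw [mem_union, mem_union] at hx
      rcases hx with hx | hx | hx
      · exact Or.inl (mem_diffs.mpr ⟨b, mem_union_right _ hb, x, mem_union_right _ hx, rfl⟩)
      · exact Or.inl (mem_diffs.mpr ⟨b, mem_union_right _ hb, x, mem_union_left _ hx, rfl⟩)
      · exact Or.inr (mem_diffs.mpr ⟨b, mem_union_left _ hb, x, mem_union_right _ hx, rfl⟩)
  calc #A + #B + #C = #B + #(A ∪ C) := by rw [hcardY]; ring
    _ ≤ #(((B ∪ (A ∪ C)) \\ B) ∪ (B \\ (B ∪ (A ∪ C)))) := hmain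
    _ ≤ #(((A ∪ B) \\ (A ∪ B)) ∪ ((B ∪ C) \\ (B ∪ C))) := card_le_card hsub

/-- Hence REL-MS also settles K♯ for every pure pair. -/
theorem kSharp_ineq_of_relMS_of_pure {α : Type} [Fintype α] [DecidableEq α] (hR : RelMS) (g h : Finset α → Lab 3)
    (hg : ∀ ⦃X Y : Finset α⦄, X ⊆ Y → g X ≤ g Y) (hh : ∀ ⦃X Y : Finset α⦄, X ⊆ Y → h X ≤ h Y) (hp : Pure g h) :
    #{q ∈ (univ : Finset (Finset α)) | IsCharged 3 g h q} ≤
      #{q ∈ (univ : Finset (Finset α)) | (g q = top ∧ h (univ \ q) = bot) ∨ (g (univ \ q) = top ∧ h q = bot)} :=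
  kSharp_ineq_of_pprime_of_pure (pprime_of_relMS hR) g h hg hh hp

end RelMS

end GeneratedDonors

end Summit.CriticalPhenomena.PercolationContinuityZ3.Theorems
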